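import Summits.Schanuel.Schanuel.Theses.RootDecomp1H
import Summits.Schanuel.Schanuel.Theorems.RootDecomp1HProductCells
import Literature.NumberTheory.Transcendental.SchanuelEclEmptyProofs

/-!
# RootDecomp1HTowerCells — the GLUE of the round-4 refinement of `BridgeCoupled` (route RootDecomp1H, lens-5 cell decomp-schanuel)

`ProductSchanuel → RelTowerSchanuel → BridgeCyclic → BridgeCoupled` (and hence `→ BridgeCS` through the landed round-3 glue
`RootDecomp1HProductCells.bridgeCSGlue_holds`): at a near-`c⋆`-optimal conjugation-stable first failure `y` whose span is NOT a
product cell, either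
* the span of `y` is a TOWER cell (has a `ℚ`-free basis `b` all of whose prefixes satisfy `trdeg ℚ(b_{<k}, e^{b_{<k}}) ≤ k`) — then
  `b` is a counterexample too (the transcendence defect transports along the span, `RootDecomp1HProductCells.trdeg_lt_of_span_eq`)
  and `RelTowerSchanuel` answers at `b`, its relativising hypothesis being supplied by `ProductSchanuel`; or
* `y` lies in the ATOMIC SPAN `span_ℚ E₁` (`E₁` = depth-one numbers) — then `ProductSchanuel` ALONE forbids the counterexample
  (elementary exchange argument `le_trdeg_of_atomicSpan`: extend `y` by atoms to a basis of a finite atom span, compare with an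
  atom basis scaled into `span_ℤ`, subadditivity of `trdeg`); or
* neither — and the square residual `BridgeCyclic` answers.
No `Prop` definitions; the non-support declarations are the two final theorems (`bridgeCoupledGlue_holds` = the glue item of an
additive re-glue, `bridgeCS_of_towerCells` = the glue of a resplit of `BridgeCS` into `ProductSchanuel ∧ RelTowerSchanuel ∧
BridgeCyclic`). Port of the lens-5 hand-off `HOME/decomp-schanuel-lens-5/g4/TowerCells.lean` §9 (rc 0, 0 sorry), landed by the census seat
(glue item stmt-Schanuel-28935; the dedup twin `trdeg_adjoin_mono` inlined).
-/

noncomputable section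

set_option linter.dupNamespace false
namespace Summit.Schanuel.Schanuel.Theorems.RootDecomp1HTowerCells

open Complex Set
open Literature.NumberTheory.Transcendental
open Summit.Schanuel.Schanuel.Theses.RootDecomp1H
open Summit.Schanuel.Schanuel.Theorems.RootDecomp1HProductCells (trdeg_lt_of_span_eq bridgeCSGlue_holds)

variable {n : ℕ}

/-! ### Tools: monotonicity and subadditivity of `trdeg`, depth-one tuples, scaling into `span_ℤ` -/

/-- `trdeg_F F(θ₁, …, θ_q) ≤ q`. -/
theorem trdeg_adjoin_range_le {F E : Type*} [Field F] [Field E] [Algebra F E] {q : ℕ} (θ : Fin q → E) :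
    Algebra.trdeg F ↥(IntermediateField.adjoin F (Set.range θ)) ≤ (q : Cardinal) := by
  haveI := isAlgebraic_adjoin_over_algebraAdjoin (F := F) (Set.range θ)
  refine (Algebra.IsAlgebraic.trdeg_le_cardinalMk F
    (((↑) : IntermediateField.adjoin F (Set.range θ) → E) ⁻¹' Set.range θ)).trans
    ((Cardinal.mk_preimage_of_injective _ _ Subtype.val_injective).trans ?_)
  simpa using Cardinal.mk_range_le_lift (f := θ)

/-- The tower law for `F ⊆ F(S) ⊆ F(S ∪ T)`. -/
theorem trdeg_adjoin_adjoin_eq {K E : Type*} [Field K] [Field E] [Algebra K E] (S T : Set E) :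
    Algebra.trdeg K (IntermediateField.adjoin K S) +
        Algebra.trdeg (IntermediateField.adjoin K S) (IntermediateField.adjoin (IntermediateField.adjoin K S) T) =
      Algebra.trdeg K (IntermediateField.adjoin K (S ∪ T)) := by
  haveI : FaithfulSMul (IntermediateField.adjoin K S)
      (IntermediateField.adjoin (IntermediateField.adjoin K S) T) :=
    (faithfulSMul_iff_algebraMap_injective (IntermediateField.adjoin K S)
      (IntermediateField.adjoin (IntermediateField.adjoin K S) T)).mpr
      (algebraMap (IntermediateField.adjoin K S) (IntermediateField.adjoin (IntermediateField.adjoin K S) T)).injective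
  have htower := trdeg_add_eq K (IntermediateField.adjoin K S)
    (A := IntermediateField.adjoin (IntermediateField.adjoin K S) T)
  have heq : Algebra.trdeg K (IntermediateField.adjoin (IntermediateField.adjoin K S) T) =
      Algebra.trdeg K (IntermediateField.adjoin K (S ∪ T)) := by
    rw [← (IntermediateField.equivOfEq (IntermediateField.adjoin_adjoin_left K S T)).trdeg_eq]
    rfl
  rw [htower, heq]

/-- Subadditivity: `trdeg_K K(S ∪ T) ≤ trdeg_K K(S) + trdeg_K K(T)`. -/
theorem trdeg_adjoin_union_le {K E : Type*} [Field K] [Field E] [Algebra K E] (S T : Set E) :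
    Algebra.trdeg K ↥(IntermediateField.adjoin K (S ∪ T)) ≤
      Algebra.trdeg K ↥(IntermediateField.adjoin K S) + Algebra.trdeg K ↥(IntermediateField.adjoin K T) := by
  have htower := trdeg_adjoin_adjoin_eq (K := K) S T
  have hbc := Literature.NumberTheory.Transcendental.trdeg_adjoin_le_of_le (K := K) (E := E)
    (F₁ := IntermediateField.adjoin K (∅ : Set E)) (F₂ := IntermediateField.adjoin K S)
    (IntermediateField.adjoin.mono K _ _ (Set.empty_subset S)) T
  have htower0 := trdeg_adjoin_adjoin_eq (K := K) (∅ : Set E) T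
  rw [Set.empty_union] at htower0
  have hzero : Algebra.trdeg K ↥(IntermediateField.adjoin K (∅ : Set E)) = 0 := by
    have h := trdeg_adjoin_range_le (F := K) (E := E) (q := 0) Fin.elim0
    have he : Set.range (Fin.elim0 : Fin 0 → E) = ∅ := Set.range_eq_empty _
    rw [he] at h
    exact nonpos_iff_eq_zero.mp (h.trans (by simp))
  rw [hzero, zero_add] at htower0
  rw [← htower, ← htower0]
  exact add_le_add (le_refl _) hbc

/-- A tuple of DEPTH-ONE numbers (`trdeg ℚ(u_j, e^{u_j}) ≤ 1`) generates a field of transcendence degree at most its length. -/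
theorem trdeg_le_of_depthOne : ∀ {k : ℕ} (u : Fin k → ℂ),
    (∀ j, Algebra.trdeg ℚ ↥(IntermediateField.adjoin ℚ ({u j, cexp (u j)} : Set ℂ)) ≤ 1) →
    Algebra.trdeg ℚ ↥(IntermediateField.adjoin ℚ (range u ∪ range (cexp ∘ u))) ≤ (k : Cardinal)
  | 0, u, _ => by
    have he : range u ∪ range (cexp ∘ u) = (∅ : Set ℂ) := by
      simp [Set.range_eq_empty]
    rw [he]
    have h := trdeg_adjoin_range_le (F := ℚ) (E := ℂ) (q := 0) Fin.elim0
    have he' : Set.range (Fin.elim0 : Fin 0 → ℂ) = ∅ := Set.range_eq_empty _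
    rw [he'] at h
    exact h
  | k + 1, u, hu => by
    have ih := trdeg_le_of_depthOne (u ∘ Fin.castSucc) fun j => hu (Fin.castSucc j)
    have hset : range u ∪ range (cexp ∘ u) ⊆
        (range (u ∘ Fin.castSucc) ∪ range (cexp ∘ (u ∘ Fin.castSucc))) ∪ {u (Fin.last k), cexp (u (Fin.last k))} := by
      rintro z (⟨i, rfl⟩ | ⟨i, rfl⟩)
      · rcases Fin.eq_castSucc_or_eq_last i with ⟨j, rfl⟩ | rfl
        · exact Or.inl (Or.inl ⟨j, rfl⟩)
        · exact Or.inr (Set.mem_insert _ _)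
      · rcases Fin.eq_castSucc_or_eq_last i with ⟨j, rfl⟩ | rfl
        · exact Or.inl (Or.inr ⟨j, rfl⟩)
        · exact Or.inr (Set.mem_insert_of_mem _ rfl)
    have hlast : Algebra.trdeg ℚ ↥(IntermediateField.adjoin ℚ ({u (Fin.last k), cexp (u (Fin.last k))} : Set ℂ)) ≤ 1 :=
      hu (Fin.last k)
    calc Algebra.trdeg ℚ ↥(IntermediateField.adjoin ℚ (range u ∪ range (cexp ∘ u)))
        ≤ Algebra.trdeg ℚ ↥(IntermediateField.adjoin ℚ
            ((range (u ∘ Fin.castSucc) ∪ range (cexp ∘ (u ∘ Fin.castSucc))) ∪ {u (Fin.last k), cexp (u (Fin.last k))})) :=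
          (trdeg_le_of_injective (IntermediateField.inclusion (IntermediateField.adjoin.mono ℚ _ _ hset))
            (IntermediateField.inclusion_injective _))
      _ ≤ Algebra.trdeg ℚ ↥(IntermediateField.adjoin ℚ (range (u ∘ Fin.castSucc) ∪ range (cexp ∘ (u ∘ Fin.castSucc)))) +
            Algebra.trdeg ℚ ↥(IntermediateField.adjoin ℚ ({u (Fin.last k), cexp (u (Fin.last k))} : Set ℂ)) :=
          trdeg_adjoin_union_le _ _
      _ ≤ (k : Cardinal) + 1 := add_le_add ih hlast
      _ = ((k + 1 : ℕ) : Cardinal) := by push_cast; rfl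

/-- A positive integer multiple of a depth-one number is depth one (`e^{Mu} = (e^u)^M`). -/
theorem depthOne_nsmul {u : ℂ} (hu : Algebra.trdeg ℚ ↥(IntermediateField.adjoin ℚ ({u, cexp u} : Set ℂ)) ≤ 1) (M : ℕ) :
    Algebra.trdeg ℚ ↥(IntermediateField.adjoin ℚ ({(M : ℚ) • u, cexp ((M : ℚ) • u)} : Set ℂ)) ≤ 1 := by
  have hle : IntermediateField.adjoin ℚ ({(M : ℚ) • u, cexp ((M : ℚ) • u)} : Set ℂ) ≤
      IntermediateField.adjoin ℚ ({u, cexp u} : Set ℂ) := by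
    rw [IntermediateField.adjoin_le_iff]
    have hu_mem : u ∈ IntermediateField.adjoin ℚ ({u, cexp u} : Set ℂ) :=
      IntermediateField.subset_adjoin ℚ _ (Set.mem_insert _ _)
    have he_mem : cexp u ∈ IntermediateField.adjoin ℚ ({u, cexp u} : Set ℂ) :=
      IntermediateField.subset_adjoin ℚ _ (Set.mem_insert_of_mem _ rfl)
    rintro z (rfl | hz)
    · rw [Rat.smul_def, Rat.cast_natCast]
      exact mul_mem (natCast_mem _ M) hu_mem
    · rw [Set.mem_singleton_iff] at hz
      subst hz
      have : cexp ((M : ℚ) • u) = (cexp u) ^ M := by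
        rw [Rat.smul_def, Rat.cast_natCast, Complex.exp_nat_mul]
      rw [this]
      exact pow_mem he_mem M
  exact (trdeg_le_of_injective (IntermediateField.inclusion hle) (IntermediateField.inclusion_injective hle)).trans hu

/-- The field of a family of INTEGER combinations of `x` (and their exponentials) lies inside `ℚ(x, eˣ)`. -/
theorem adjoin_le_of_mem_span_int {ι κ : Type*} (x : ι → ℂ) (z : κ → ℂ)
    (hz : ∀ i, z i ∈ Submodule.span ℤ (range x)) :
    IntermediateField.adjoin ℚ (range z ∪ range (cexp ∘ z)) ≤ IntermediateField.adjoin ℚ (range x ∪ range (cexp ∘ x)) := by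
  rw [IntermediateField.adjoin_le_iff]
  rintro a (⟨i, rfl⟩ | ⟨i, rfl⟩)
  · exact (Literature.NumberTheory.Transcendental.mem_adjoin_of_mem_span_int x (hz i)).1
  · exact (Literature.NumberTheory.Transcendental.mem_adjoin_of_mem_span_int x (hz i)).2

/-- Hence its transcendence degree is at most that of `ℚ(x, eˣ)`. -/
theorem trdeg_le_of_mem_span_int {ι κ : Type*} (x : ι → ℂ) (z : κ → ℂ)
    (hz : ∀ i, z i ∈ Submodule.span ℤ (range x)) :
    Algebra.trdeg ℚ ↥(IntermediateField.adjoin ℚ (range z ∪ range (cexp ∘ z))) ≤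
      Algebra.trdeg ℚ ↥(IntermediateField.adjoin ℚ (range x ∪ range (cexp ∘ x))) :=
  trdeg_le_of_injective (IntermediateField.inclusion (adjoin_le_of_mem_span_int x z hz))
    (IntermediateField.inclusion_injective _)

/-- Clearing denominators familywise. -/
theorem exists_scaled_family {κ ι : Type*} (x : ι → ℂ) (u : κ → ℂ) (hu : ∀ i, u i ∈ Submodule.span ℚ (range x)) :
    ∃ M : κ → ℕ, (∀ i, M i ≠ 0) ∧ ∀ i, ((M i : ℚ) • u i) ∈ Submodule.span ℤ (range x) := by
  choose M hM hmem using fun i => Literature.NumberTheory.Transcendental.exists_nsmul_mem_span_int x (hu i)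
  exact ⟨M, hM, hmem⟩

/-- Scaling each member of a ℚ-independent family by a non-zero natural number keeps it ℚ-independent. -/
theorem linearIndependent_scaled {κ : Type*} {u : κ → ℂ} (hu : LinearIndependent ℚ u) (M : κ → ℕ) (hM : ∀ i, M i ≠ 0) :
    LinearIndependent ℚ (fun i => (M i : ℚ) • u i) := by
  let c : κ → ℚˣ := fun i => Units.mk0 (M i : ℚ) (Nat.cast_ne_zero.mpr (hM i))
  have he : c • u = fun i => (M i : ℚ) • u i := by
    funext i; simp only [Pi.smul_apply', c, Units.smul_def, Units.val_mk0]
  exact he ▸ hu.units_smul c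

/-- Enumerate a finite set of complex numbers by `Fin N`. -/
theorem exists_fin_enum {B : Set ℂ} (hB : B.Finite) :
    ∃ (N : ℕ) (z : Fin N → ℂ), Function.Injective z ∧ range z = B ∧ B.ncard = N := by
  haveI := hB.to_subtype
  obtain ⟨N, ⟨e⟩⟩ := Finite.exists_equiv_fin B
  refine ⟨N, fun i => ((e.symm i : B) : ℂ), ?_, ?_, ?_⟩
  · intro i j hij
    exact e.symm.injective (Subtype.ext hij)
  · ext z
    constructor
    · rintro ⟨i, rfl⟩; exact (e.symm i).2
    · intro hz; exact ⟨e ⟨z, hz⟩, by simp⟩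
  · rw [← Nat.card_coe_set_eq B, Nat.card_congr e, Nat.card_eq_fintype_card, Fintype.card_fin]

/-! ### Under `ProductSchanuel`, Schanuel holds on the whole ATOMIC SPAN `span_ℚ E₁` (exchange argument, no Jacobians) -/

/-- **P-PROD ⟹ SCHANUEL ON THE ATOMIC SPAN**: a `ℚ`-free tuple inside `span_ℚ {w | trdeg ℚ(w, e^w) ≤ 1}` is not a counterexample. -/
theorem le_trdeg_of_atomicSpan (hPS : ProductSchanuel) {y : Fin n → ℂ}
    (hy : ∀ j, y j ∈ Submodule.span ℚ {w : ℂ | Algebra.trdeg ℚ ↥(IntermediateField.adjoin ℚ ({w, cexp w} : Set ℂ)) ≤ 1})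
    (hli : LinearIndependent ℚ y) :
    (n : Cardinal) ≤ Algebra.trdeg ℚ ↥(IntermediateField.adjoin ℚ (range y ∪ range (cexp ∘ y))) := by
  classical
  by_contra hlt
  rw [not_le] at hlt
  -- (1) finitely many atoms `A` with `y ⊂ span_ℚ A`
  choose S hSD hyS using fun j => Submodule.mem_span_finite_of_mem_span (hy j)
  let A : Finset ℂ := Finset.univ.biUnion S
  have hAD : ∀ a ∈ (A : Set ℂ), Algebra.trdeg ℚ ↥(IntermediateField.adjoin ℚ ({a, cexp a} : Set ℂ)) ≤ 1 := by
    intro a ha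
    rw [Finset.mem_coe, Finset.mem_biUnion] at ha
    obtain ⟨j, -, hj⟩ := ha
    exact hSD j hj
  have hyA : ∀ j, y j ∈ Submodule.span ℚ (A : Set ℂ) := by
    intro j
    refine Submodule.span_mono ?_ (hyS j)
    intro a ha
    rw [Finset.mem_coe, Finset.mem_biUnion]
    exact ⟨j, Finset.mem_univ _, ha⟩
  -- (2) extend `s = range y` by atoms to a basis `B` of `span (s ∪ A) = span A`
  set s : Set ℂ := range y with hs_def
  set t : Set ℂ := s ∪ (A : Set ℂ) with ht_def
  have hst : s ⊆ t := Set.subset_union_left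
  have hs : LinearIndepOn ℚ id s := hli.linearIndepOn_id
  set B : Set ℂ := hs.extend hst with hB_def
  have hsB : s ⊆ B := hs.subset_extend hst
  have hBt : B ⊆ t := hs.extend_subset hst
  have htB : t ⊆ Submodule.span ℚ B := hs.subset_span_extend hst
  have hBli : LinearIndepOn ℚ id B := hs.linearIndepOn_extend hst
  have htfin : t.Finite := (Set.finite_range y).union A.finite_toSet
  have hBfin : B.Finite := htfin.subset hBt
  set C : Set ℂ := B \ s with hC_def
  have hCfin : C.Finite := hBfin.subset Set.sdiff_subset
  have hCA : ∀ a ∈ C, Algebra.trdeg ℚ ↥(IntermediateField.adjoin ℚ ({a, cexp a} : Set ℂ)) ≤ 1 := by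
    intro a ha
    rcases hBt ha.1 with has | haA
    · exact (ha.2 has).elim
    · exact hAD a haA
  -- (3) an atom basis `B'` of `span A`
  obtain ⟨B', hB'A, hspanB', hB'li⟩ := exists_linearIndependent ℚ (A : Set ℂ)
  have hB'fin : B'.Finite := A.finite_toSet.subset hB'A
  have hspan_t : Submodule.span ℚ t = Submodule.span ℚ (A : Set ℂ) := by
    apply le_antisymm
    · rw [Submodule.span_le]
      rintro a (⟨j, rfl⟩ | ha)
      · exact hyA j
      · exact Submodule.subset_span ha
    · exact Submodule.span_mono Set.subset_union_right
  have hspanB : Submodule.span ℚ B = Submodule.span ℚ (A : Set ℂ) := by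
    rw [← hspan_t]; exact hs.span_extend_eq_span hst
  -- (4) enumerations
  obtain ⟨N, u, hu_inj, hu_range, hB'card⟩ := exists_fin_enum hB'fin
  obtain ⟨N₂, z, hz_inj, hz_range, hBcard⟩ := exists_fin_enum hBfin
  obtain ⟨p, w, hw_inj, hw_range, hCcard⟩ := exists_fin_enum hCfin
  have hu_li : LinearIndependent ℚ u := by
    have h1 : LinearIndepOn ℚ id (range u) := by rw [hu_range]; exact hB'li
    exact (linearIndepOn_id_range_iff hu_inj).1 h1
  have hz_li : LinearIndependent ℚ z := by
    have h1 : LinearIndepOn ℚ id (range z) := by rw [hz_range]; exact hBli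
    exact (linearIndepOn_id_range_iff hz_inj).1 h1
  -- (5) dimension count: `N = N₂ = n + p`
  have hNN₂ : N = N₂ := by
    have h1 : Module.finrank ℚ (Submodule.span ℚ (range u)) = N := by
      rw [finrank_span_eq_card hu_li, Fintype.card_fin]
    have h2 : Module.finrank ℚ (Submodule.span ℚ (range z)) = N₂ := by
      rw [finrank_span_eq_card hz_li, Fintype.card_fin]
    have h3 : Submodule.span ℚ (range u) = Submodule.span ℚ (range z) := by
      rw [hu_range, hz_range, hspanB', hspanB]
    rw [← h1, ← h2, h3]
  have hcount : p + n = N₂ := by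
    have h1 : C.ncard + s.ncard = B.ncard := Set.ncard_sdiff_add_ncard_of_subset hsB hBfin
    have h2 : s.ncard = n := by
      rw [hs_def, Set.ncard_range_of_injective hli.injective, Nat.card_eq_fintype_card, Fintype.card_fin]
    omega
  -- (6a) `ProductSchanuel` at the scaled atom basis: `N ≤ trdeg ℚ(ũ, e^ũ) ≤ trdeg ℚ(z, e^z)`
  have hu_span : ∀ i, u i ∈ Submodule.span ℚ (range z) := by
    intro i
    rw [hz_range]
    exact htB (Or.inr (hB'A (hu_range ▸ ⟨i, rfl⟩)))
  obtain ⟨M, hM, hMmem⟩ := exists_scaled_family z u hu_span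
  have hũ_li := linearIndependent_scaled hu_li M hM
  have hũ_dep : ∀ i, Algebra.trdeg ℚ ↥(IntermediateField.adjoin ℚ ({(M i : ℚ) • u i, cexp ((M i : ℚ) • u i)} : Set ℂ)) ≤ 1 :=
    fun i => depthOne_nsmul (hAD _ (hB'A (hu_range ▸ ⟨i, rfl⟩))) (M i)
  have hPSu := hPS N (fun i => (M i : ℚ) • u i) hũ_dep hũ_li
  have h6a : (N : Cardinal) ≤ Algebra.trdeg ℚ ↥(IntermediateField.adjoin ℚ (range z ∪ range (cexp ∘ z))) :=
    hPSu.trans (trdeg_le_of_mem_span_int z (fun i => (M i : ℚ) • u i) hMmem)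
  -- (6b) `ℚ(z, e^z) ⊆ ℚ((y, e^y) ∪ (w, e^w))` and subadditivity
  have hzset : range z ∪ range (cexp ∘ z) ⊆ (range y ∪ range (cexp ∘ y)) ∪ (range w ∪ range (cexp ∘ w)) := by
    have hB_eq : B = s ∪ C := by
      rw [hC_def, Set.union_sdiff_cancel hsB]
    rintro a (⟨i, rfl⟩ | ⟨i, rfl⟩)
    · have hzi : z i ∈ B := hz_range ▸ ⟨i, rfl⟩
      rw [hB_eq] at hzi
      rcases hzi with ⟨j, hj⟩ | hzi
      · exact Or.inl (Or.inl ⟨j, hj⟩)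
      · rw [← hw_range] at hzi
        obtain ⟨j, hj⟩ := hzi
        exact Or.inr (Or.inl ⟨j, hj⟩)
    · have hzi : z i ∈ B := hz_range ▸ ⟨i, rfl⟩
      rw [hB_eq] at hzi
      rcases hzi with ⟨j, hj⟩ | hzi
      · exact Or.inl (Or.inr ⟨j, by simp [hj]⟩)
      · rw [← hw_range] at hzi
        obtain ⟨j, hj⟩ := hzi
        exact Or.inr (Or.inr ⟨j, by simp [hj]⟩)
  have hw_dep : ∀ j, Algebra.trdeg ℚ ↥(IntermediateField.adjoin ℚ ({w j, cexp (w j)} : Set ℂ)) ≤ 1 :=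
    fun j => hCA _ (hw_range ▸ ⟨j, rfl⟩)
  have h6b : Algebra.trdeg ℚ ↥(IntermediateField.adjoin ℚ (range z ∪ range (cexp ∘ z))) ≤
      Algebra.trdeg ℚ ↥(IntermediateField.adjoin ℚ (range y ∪ range (cexp ∘ y))) + (p : Cardinal) :=
    calc Algebra.trdeg ℚ ↥(IntermediateField.adjoin ℚ (range z ∪ range (cexp ∘ z)))
        ≤ Algebra.trdeg ℚ ↥(IntermediateField.adjoin ℚ ((range y ∪ range (cexp ∘ y)) ∪ (range w ∪ range (cexp ∘ w)))) :=
          (trdeg_le_of_injective (IntermediateField.inclusion (IntermediateField.adjoin.mono ℚ _ _ hzset))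
            (IntermediateField.inclusion_injective _))
      _ ≤ Algebra.trdeg ℚ ↥(IntermediateField.adjoin ℚ (range y ∪ range (cexp ∘ y))) +
            Algebra.trdeg ℚ ↥(IntermediateField.adjoin ℚ (range w ∪ range (cexp ∘ w))) := trdeg_adjoin_union_le _ _
      _ ≤ Algebra.trdeg ℚ ↥(IntermediateField.adjoin ℚ (range y ∪ range (cexp ∘ y))) + (p : Cardinal) :=
          add_le_add (le_refl _) (trdeg_le_of_depthOne w hw_dep)
  -- (7) finite arithmetic: `trdeg ℚ(y, e^y) = t < n`, `N ≤ t + p`, `N = n + p`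
  obtain ⟨t, ht⟩ := Cardinal.lt_aleph0.mp (hlt.trans (Cardinal.natCast_lt_aleph0 (n := n)))
  have hN : (N : Cardinal) ≤ Algebra.trdeg ℚ ↥(IntermediateField.adjoin ℚ (range y ∪ range (cexp ∘ y))) + (p : Cardinal) :=
    h6a.trans h6b
  rw [ht] at hN hlt
  norm_cast at hN hlt
  omega

/-! ### Under `ProductSchanuel ∧ RelTowerSchanuel`, a TOWER cell carries no counterexample -/

/-- If `span_ℚ y = span_ℚ b` for a `ℚ`-free tower tuple `b`, then `y` is not a counterexample. -/
theorem not_lt_of_towerSpan (hPS : ProductSchanuel) (hRT : RelTowerSchanuel) {y b : Fin n → ℂ}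
    (hb : LinearIndependent ℚ b)
    (htow : ∀ (k : ℕ) (hk : k ≤ n), Algebra.trdeg ℚ ↥(IntermediateField.adjoin ℚ
      (Set.range (b ∘ Fin.castLE hk) ∪ Set.range (Complex.exp ∘ (b ∘ Fin.castLE hk)))) ≤ (k : Cardinal))
    (hyb : Submodule.span ℚ (Set.range y) = Submodule.span ℚ (Set.range b)) :
    ¬ Algebra.trdeg ℚ ↥(IntermediateField.adjoin ℚ (range y ∪ range (cexp ∘ y))) < (n : Cardinal) := by
  intro hlt
  have hcb := trdeg_lt_of_span_eq hyb hlt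
  exact absurd (hRT n b htow hb (fun m u hdep hu _ => hPS m u hdep hu)) (not_le.2 hcb)

/-! ### The glue -/

/-- **GLUE (additive re-glue)**: `ProductSchanuel → RelTowerSchanuel → BridgeCyclic → BridgeCoupled`. -/
theorem bridgeCoupledGlue_holds : BridgeCoupledGlue := by
  intro hPS hRT hCyc n c hlow y hopt hcs hce hnp
  by_cases hat : ∀ j, y j ∈ Submodule.span ℚ
      {w : ℂ | Algebra.trdeg ℚ ↥(IntermediateField.adjoin ℚ ({w, Complex.exp w} : Set ℂ)) ≤ 1}
  · exact absurd (le_trdeg_of_atomicSpan hPS hat hce.1) (not_le.2 hce.2)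
  · by_cases htow : ∃ b : Fin n → ℂ, LinearIndependent ℚ b ∧
        (∀ (k : ℕ) (hk : k ≤ n), Algebra.trdeg ℚ ↥(IntermediateField.adjoin ℚ
          (Set.range (b ∘ Fin.castLE hk) ∪ Set.range (Complex.exp ∘ (b ∘ Fin.castLE hk)))) ≤ (k : Cardinal)) ∧
        Submodule.span ℚ (Set.range y) = Submodule.span ℚ (Set.range b)
    · obtain ⟨b, hb, htb, hyb⟩ := htow
      exact absurd hce.2 (not_lt_of_towerSpan hPS hRT hb htb hyb)
    · exact hCyc n c hlow y hopt hcs hce hnp hat htow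

/-- **GLUE (resplit of `BridgeCS`)**: `ProductSchanuel → RelTowerSchanuel → BridgeCyclic → BridgeCS`, through the landed round-3 glue. -/
theorem bridgeCS_of_towerCells (hPS : ProductSchanuel) (hRT : RelTowerSchanuel) (hCyc : BridgeCyclic) : BridgeCS :=
  bridgeCSGlue_holds hPS (bridgeCoupledGlue_holds hPS hRT hCyc)

end Summit.Schanuel.Schanuel.Theorems.RootDecomp1HTowerCells
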